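import Literature.Computability.Complexity.CRRFacts
import HarnessLib

/-!
# Chinese remainder reconstruction, rank, and exact halving (arithmetic core)

Pure arithmetic (theorems only) behind the conversion from Chinese remainder representation to
binary inside the counting hierarchy (Hesse–Allender–Barrington, JCSS 65 (2002), §4; Bürgisser,
ECCC TR06-113, Thm. 3.4 / 3.7). For a finite set `S` of primes with product `B` and a number `Y`
known through its residues `Y mod q`, `q ∈ S`:

* **reconstruction** (`crrSum_mod_eq`, `crrSum_mod_prod`): with `h_q · (B/q) ≡ 1 (mod q)` the sum
  `C = ∑_{q∈S} (Y mod q) · h_q · (B/q)` is `≡ Y (mod B)`, i.e. `C = (Y mod B) + rank · B`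
  ("`X` is equal, as an integer, to `(∑ xᵢhᵢCᵢ) − rM` for some particular number `r`, called the
  rank", HAB §4);
* **the rank from an iterated sum** (`two_pow_mul_crrSum_eq`, `crrSum_div_eq_approx_div`): with the
  integer approximations `⌊2ᵀ/q⌋` of `2ᵀ/q`,
  `2ᵀ · C = B · ∑_q (Y mod q) h_q ⌊2ᵀ/q⌋ + E` with `0 ≤ E ≤ |S| · Q² · B`, whence
  `rank = ⌊(∑_q (Y mod q) h_q ⌊2ᵀ/q⌋) / 2ᵀ⌋` as soon as `2ᵀ > |S| Q² B` — the rank is read off the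
  high-order bits of ONE iterated sum (HAB §4, proof of Lemma 4.3, "we can compute `X/M` to
  polynomially many bits of accuracy … since the rank is an integer"); and the residues of
  `Y mod B` modulo other primes follow (`mod_prod_eq_crrSum_sub`, `sub_mod_eq`);
* **exact halving** (`mul_prod_succ_le`, `div_prod_eq_div_two_pow`): for numbers
  `A_i ≥ A` with `2s ≤ A` and `2sX < A`, `K = ∏ (A_i + 1)/2`, `B = ∏ A_i`:
  `⌊X K / B⌋ = ⌊X / 2ˢ⌋` EXACTLY (HAB §4, proof of Thm. 4.1, "dividing `X` by `2ˢ` is quite similar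
  to multiplying `X` by `∏ (1+Aᵢ)/2 / ∏ Aᵢ`", here with the error pushed below the resolution so
  that no correction step is needed), the quotient's residues (`div_mod_eq_of_mod`), and the bit
  read off two consecutive quotients modulo `3` (`testBit_eq_decide_div_mod_three`);
* inverses modulo a prime by Fermat (`mod_pow_sub_two_mul_mod`), and modulo `3` (`mul_self_mod_three`).

## References

* W. Hesse, E. Allender, D. A. M. Barrington, JCSS 65 (2002), §4 (rank; Lemma 4.3; Thm. 4.1).
* P. Bürgisser, ECCC TR06-113 (2006), Thm. 3.4, Thm. 3.7.
-/

namespace Literature.Computability.Complexity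

open Finset Nat

/-! ### Reconstruction modulo the basis product -/

section Reconstruction

variable (S : Finset ℕ)

/-- `(B/q) · q = B` for `q ∈ S`. [folklore] -/
theorem prod_erase_mul_eq {q : ℕ} (hq : q ∈ S) : (∏ r ∈ S.erase q, r) * q = ∏ r ∈ S, r :=
  Finset.prod_erase_mul S id hq

/-- Every other cofactor `B/p`, `p ≠ q`, is divisible by `q`. [folklore] -/
theorem dvd_prod_erase_of_ne {p q : ℕ} (hq : q ∈ S) (hpq : p ≠ q) : q ∣ ∏ r ∈ S.erase p, r :=
  Finset.dvd_prod_of_mem _ (Finset.mem_erase.2 ⟨hpq.symm, hq⟩)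

/-- **Reconstruction, residue by residue**: if `h_q · (B/q) ≡ 1 (mod q)` then
`∑_{p∈S} y_p h_p (B/p) ≡ y_q (mod q)` for `q ∈ S`. [cite: HesseAllenderBarrington2002, §4] -/
theorem crrSum_mod_eq (y h : ℕ → ℕ) {q : ℕ} (hq : q ∈ S)
    (hh : h q * (∏ r ∈ S.erase q, r) % q = 1) :
    (∑ p ∈ S, y p * h p * ∏ r ∈ S.erase p, r) % q = y q % q := by
  classical
  rw [← Finset.add_sum_erase S _ hq, Nat.add_mod]
  have hrest : (∑ p ∈ S.erase q, y p * h p * ∏ r ∈ S.erase p, r) % q = 0 := by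
    apply Nat.mod_eq_zero_of_dvd
    refine Finset.dvd_sum fun p hp => ?_
    exact Dvd.dvd.mul_left (dvd_prod_erase_of_ne S hq (Finset.mem_erase.1 hp).1) _
  rw [hrest, add_zero, Nat.mod_mod, mul_assoc, Nat.mul_mod, hh, mul_one, Nat.mod_mod]

/-- **Reconstruction modulo the basis product**: for a set of primes `S` with product `B`,
`∑_{p∈S} (Y mod p) h_p (B/p) ≡ Y (mod B)`. [cite: HesseAllenderBarrington2002, §4] -/
theorem crrSum_mod_prod (hS : ∀ p ∈ S, p.Prime) (Y : ℕ) (h : ℕ → ℕ)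
    (hh : ∀ q ∈ S, h q * (∏ r ∈ S.erase q, r) % q = 1) :
    (∑ p ∈ S, (Y % p) * h p * ∏ r ∈ S.erase p, r) % (∏ p ∈ S, p) = Y % (∏ p ∈ S, p) :=
  mod_prod_eq_of_forall_mod_eq hS fun q hq => by rw [crrSum_mod_eq S _ h hq (hh q hq), Nat.mod_mod]

/-- The reconstruction sum is `(Y mod B) + B · rank` with `rank = sum / B`. [cite: HesseAllenderBarrington2002, §4] -/
theorem crrSum_eq_mod_add_mul_rank (hS : ∀ p ∈ S, p.Prime) (Y : ℕ) (h : ℕ → ℕ)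
    (hh : ∀ q ∈ S, h q * (∏ r ∈ S.erase q, r) % q = 1) :
    (∑ p ∈ S, (Y % p) * h p * ∏ r ∈ S.erase p, r) =
      Y % (∏ p ∈ S, p) + (∏ p ∈ S, p) * ((∑ p ∈ S, (Y % p) * h p * ∏ r ∈ S.erase p, r) / ∏ p ∈ S, p) := by
  conv_lhs => rw [← Nat.mod_add_div (∑ p ∈ S, (Y % p) * h p * ∏ r ∈ S.erase p, r) (∏ p ∈ S, p),
    crrSum_mod_prod S hS Y h hh]

end Reconstruction

/-! ### The rank from the high-order bits of an iterated sum -/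

section Rank

variable (S : Finset ℕ)

/-- **The approximation identity**: `2ᵀ · ∑_p c_p (B/p) = B · ∑_p c_p ⌊2ᵀ/p⌋ + ∑_p c_p (B/p) (2ᵀ mod p)`
(from `(B/p) · p = B` and `2ᵀ = p ⌊2ᵀ/p⌋ + 2ᵀ mod p`). [cite: HesseAllenderBarrington2002, Lemma 4.3] -/
theorem two_pow_mul_crrSum_eq (c : ℕ → ℕ) (T : ℕ) :
    2 ^ T * (∑ p ∈ S, c p * ∏ r ∈ S.erase p, r) =
      (∏ p ∈ S, p) * (∑ p ∈ S, c p * (2 ^ T / p)) + ∑ p ∈ S, c p * (∏ r ∈ S.erase p, r) * (2 ^ T % p) := by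
  rw [Finset.mul_sum, Finset.mul_sum, ← Finset.sum_add_distrib]
  refine Finset.sum_congr rfl fun p hp => ?_
  rw [← prod_erase_mul_eq S hp]
  have := Nat.div_add_mod (2 ^ T) p
  calc 2 ^ T * (c p * ∏ r ∈ S.erase p, r) = (p * (2 ^ T / p) + 2 ^ T % p) * (c p * ∏ r ∈ S.erase p, r) := by rw [this]
    _ = _ := by ring

/-- The error term is at most `|S| · Q² · B` when `c_p < p² ` and all `p ≤ Q`. [folklore] -/
theorem crrErr_le (c : ℕ → ℕ) (T Q : ℕ) (hc : ∀ p ∈ S, c p ≤ p * p) (hQ : ∀ p ∈ S, p ≤ Q) (hpos : ∀ p ∈ S, 0 < p) :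
    ∑ p ∈ S, c p * (∏ r ∈ S.erase p, r) * (2 ^ T % p) ≤ S.card * (Q * Q) * ∏ p ∈ S, p := by
  have hterm : ∀ p ∈ S, c p * (∏ r ∈ S.erase p, r) * (2 ^ T % p) ≤ (Q * Q) * ∏ p ∈ S, p := by
    intro p hp
    rw [← prod_erase_mul_eq S hp]
    have h1 : 2 ^ T % p ≤ p := (Nat.mod_lt _ (hpos p hp)).le
    have h2 : c p ≤ Q * Q := (hc p hp).trans (Nat.mul_le_mul (hQ p hp) (hQ p hp))
    calc c p * (∏ r ∈ S.erase p, r) * (2 ^ T % p) ≤ (Q * Q) * (∏ r ∈ S.erase p, r) * p :=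
          Nat.mul_le_mul (Nat.mul_le_mul_right _ h2) h1
      _ = (Q * Q) * ((∏ r ∈ S.erase p, r) * p) := by ring
  calc ∑ p ∈ S, c p * (∏ r ∈ S.erase p, r) * (2 ^ T % p) ≤ ∑ _p ∈ S, (Q * Q) * ∏ p ∈ S, p := Finset.sum_le_sum hterm
    _ = S.card * (Q * Q) * ∏ p ∈ S, p := by rw [Finset.sum_const, smul_eq_mul]; ring

/-- **The rank is the high part of the approximation sum.** If `2ᵀ C = B A + E` with `E ≤ D · B`,
`D · B < 2ᵀ` and `C = Y₀ + B · rk` with either `Y₀ ≥ 1` or `C = 0 ∧ A = 0`, and `Y₀ < B`, then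
`A / 2ᵀ = rk`. (Abstract form; instantiated by `two_pow_mul_crrSum_eq`, `crrErr_le`,
`crrSum_eq_mod_add_mul_rank`.) [cite: HesseAllenderBarrington2002, Lemma 4.3] -/
theorem div_two_pow_eq_rank {T B A C E D Y₀ rk : ℕ} (hid : 2 ^ T * C = B * A + E) (hE : E ≤ D * B)
    (hD : D * B < 2 ^ T) (hC : C = Y₀ + B * rk) (hY : Y₀ < B) (hcase : 1 ≤ Y₀ ∨ (C = 0 ∧ A = 0)) :
    A / 2 ^ T = rk := by
  have hB : 0 < B := by omega
  rcases hcase with hY1 | ⟨hC0, hA0⟩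
  · -- `B A = 2^T Y₀ + 2^T B rk - E` with `E < 2^T ≤ 2^T Y₀`
    have hElt : E < 2 ^ T := lt_of_le_of_lt hE hD
    have key : B * A = B * (2 ^ T * rk) + (2 ^ T * Y₀ - E) := by
      have h1 : 2 ^ T * Y₀ ≥ E := (hElt.le).trans (Nat.le_mul_of_pos_right _ (by omega))
      zify [h1] at hid ⊢
      rw [hC] at hid
      push_cast at hid
      linarith
    -- `2^T Y₀ - E = B V` with `V < 2^T`
    have hdvd : B ∣ 2 ^ T * Y₀ - E := by
      have : B ∣ B * A - B * (2 ^ T * rk) := Nat.dvd_sub (dvd_mul_right _ _) (dvd_mul_right _ _)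
      rwa [key, Nat.add_sub_cancel_left] at this
    obtain ⟨V, hV⟩ := hdvd
    have hVlt : V < 2 ^ T := by
      have : B * V < B * 2 ^ T := by
        rw [← hV]
        calc 2 ^ T * Y₀ - E ≤ 2 ^ T * Y₀ := Nat.sub_le _ _
          _ < 2 ^ T * B := Nat.mul_lt_mul_of_pos_left hY (Nat.two_pow_pos T)
          _ = B * 2 ^ T := mul_comm _ _
      exact Nat.lt_of_mul_lt_mul_left this
    have hA : A = 2 ^ T * rk + V := by
      apply Nat.eq_of_mul_eq_mul_left hB
      rw [key, hV]; ring
    rw [hA, Nat.mul_add_div (Nat.two_pow_pos T), Nat.div_eq_of_lt hVlt, add_zero]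
  · subst hC0
    have hrk : rk = 0 := by
      rcases Nat.eq_zero_or_pos rk with h | h
      · exact h
      · exfalso
        have : 0 < Y₀ + B * rk := Nat.add_pos_right _ (Nat.mul_pos hB h)
        omega
    rw [hA0, hrk, Nat.zero_div]

/-- **The rank of a number known by its residues**, assembled: for a set of primes `S` with
product `B`, all `p ≤ Q`, inverses `h_q < q` of the cofactors, and `2ᵀ > |S| Q² B`:
`(∑_q (Y mod q) h_q ⌊2ᵀ/q⌋) / 2ᵀ = (∑_q (Y mod q) h_q (B/q)) / B`. [cite: HesseAllenderBarrington2002, Lemma 4.3] -/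
theorem crrSum_div_eq_approx_div (hS : ∀ p ∈ S, p.Prime) (Y T Q : ℕ) (h : ℕ → ℕ)
    (hh : ∀ q ∈ S, h q * (∏ r ∈ S.erase q, r) % q = 1) (hhlt : ∀ q ∈ S, h q < q)
    (hQ : ∀ p ∈ S, p ≤ Q) (hT : S.card * (Q * Q) * (∏ p ∈ S, p) < 2 ^ T) :
    (∑ p ∈ S, (Y % p) * h p * (2 ^ T / p)) / 2 ^ T =
      (∑ p ∈ S, (Y % p) * h p * ∏ r ∈ S.erase p, r) / ∏ p ∈ S, p := by
  set c : ℕ → ℕ := fun p => (Y % p) * h p with hc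
  have hid := two_pow_mul_crrSum_eq S c T
  have hE := crrErr_le S c T Q (fun p hp => Nat.mul_le_mul (Nat.mod_lt _ (hS p hp).pos).le (hhlt p hp).le) hQ
    (fun p hp => (hS p hp).pos)
  have hsum := crrSum_eq_mod_add_mul_rank S hS Y h hh
  have hsum' : (∑ p ∈ S, c p * ∏ r ∈ S.erase p, r) =
      Y % (∏ p ∈ S, p) + (∏ p ∈ S, p) * ((∑ p ∈ S, c p * ∏ r ∈ S.erase p, r) / ∏ p ∈ S, p) := by
    simpa only [hc] using hsum
  have hBpos : 0 < ∏ p ∈ S, p := Finset.prod_pos fun p hp => (hS p hp).pos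
  refine div_two_pow_eq_rank hid hE hT hsum' (Nat.mod_lt _ hBpos) ?_
  by_cases hY : 1 ≤ Y % ∏ p ∈ S, p
  · exact Or.inl hY
  · right
    have hY0 : Y % ∏ p ∈ S, p = 0 := by omega
    have hc0 : ∀ p ∈ S, c p = 0 := fun p hp => by
      have : Y % p = 0 := by
        have hdvd : p ∣ Y := (Finset.dvd_prod_of_mem _ hp).trans (Nat.dvd_of_mod_eq_zero hY0)
        exact Nat.mod_eq_zero_of_dvd hdvd
      simp [hc, this]
    exact ⟨Finset.sum_eq_zero fun p hp => by rw [hc0 p hp, zero_mul],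
      Finset.sum_eq_zero fun p hp => by rw [show Y % p * h p = c p from rfl, hc0 p hp, zero_mul]⟩

/-- **Residues of `Y mod B` modulo another prime** from the reconstruction sum and the rank:
`(Y mod B) mod m = (C mod m + m · k - (B · rank) mod m) mod m`-style identity, in the exact form
`Y mod B = C - B · rank`. [cite: HesseAllenderBarrington2002, §4] -/
theorem mod_prod_eq_crrSum_sub (hS : ∀ p ∈ S, p.Prime) (Y : ℕ) (h : ℕ → ℕ)
    (hh : ∀ q ∈ S, h q * (∏ r ∈ S.erase q, r) % q = 1) :
    Y % (∏ p ∈ S, p) = (∑ p ∈ S, (Y % p) * h p * ∏ r ∈ S.erase p, r) -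
      (∏ p ∈ S, p) * ((∑ p ∈ S, (Y % p) * h p * ∏ r ∈ S.erase p, r) / ∏ p ∈ S, p) := by
  have := crrSum_eq_mod_add_mul_rank S hS Y h hh
  omega

/-- Residues of a difference: `(a - b) mod m = (a mod m + m - b mod m) mod m` for `b ≤ a`. [folklore] -/
theorem sub_mod_eq (a b m : ℕ) (hba : b ≤ a) (hm : 0 < m) : (a - b) % m = (a % m + m - b % m) % m := by
  have hb : b % m ≤ a % m + m := by have := Nat.mod_lt b hm; omega
  zify [hba, hb]
  rw [Int.sub_emod, show ((a : ℤ) % m + m - (b : ℤ) % m) = ((a : ℤ) % m - (b : ℤ) % m) + m by ring, Int.add_emod_right]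

end Rank

/-! ### Exact halving -/

section Halving

/-- `A · ∏_{i<s} (f i + 1) ≤ (A + 2s) · ∏_{i<s} f i` when all `f i ≥ A ≥ 2s`
(so `∏ (1 + 1/fᵢ) ≤ 1 + 2s/A`). [cite: HesseAllenderBarrington2002, Theorem 4.1] -/
theorem mul_prod_succ_le (A : ℕ) (f : ℕ → ℕ) : ∀ s : ℕ, (∀ i < s, A ≤ f i) → 2 * s ≤ A →
    A * ∏ i ∈ range s, (f i + 1) ≤ (A + 2 * s) * ∏ i ∈ range s, f i
  | 0, _, _ => by simp
  | s + 1, hf, hs => by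
    have ih := mul_prod_succ_le A f s (fun i hi => hf i (Nat.lt_succ_of_lt hi)) (by omega)
    have hfs : A ≤ f s := hf s (Nat.lt_succ_self s)
    rw [prod_range_succ, prod_range_succ, ← mul_assoc]
    calc A * (∏ i ∈ range s, (f i + 1)) * (f s + 1) ≤ (A + 2 * s) * (∏ i ∈ range s, f i) * (f s + 1) :=
          Nat.mul_le_mul_right _ ih
      _ = (A + 2 * s) * (∏ i ∈ range s, f i) * f s + (A + 2 * s) * ∏ i ∈ range s, f i := by ring
      _ ≤ (A + 2 * s) * (∏ i ∈ range s, f i) * f s + 2 * f s * ∏ i ∈ range s, f i :=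
          Nat.add_le_add_left (Nat.mul_le_mul_right _ (by omega)) _
      _ = (A + 2 * (s + 1)) * ((∏ i ∈ range s, f i) * f s) := by ring

/-- **Exact halving by a quotient of smooth numbers** (HAB 2002, proof of Thm. 4.1, sharpened):
if `2ˢ K = ∏_{i<s} (A_i + 1)`, `B = ∏_{i<s} A_i`, all `A_i ≥ A`, `2s ≤ A` and `2sX < A`, then
`⌊X K / B⌋ = ⌊X / 2ˢ⌋`. [cite: HesseAllenderBarrington2002, Theorem 4.1] -/
theorem div_prod_eq_div_two_pow (X s A K : ℕ) (f : ℕ → ℕ) (hK : 2 ^ s * K = ∏ i ∈ range s, (f i + 1))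
    (hf : ∀ i < s, A ≤ f i) (hs : 2 * s ≤ A) (hX : 2 * s * X < A) :
    X * K / (∏ i ∈ range s, f i) = X / 2 ^ s := by
  set B := ∏ i ∈ range s, f i with hB
  have hApos : 0 < A := by omega
  have hBpos : 0 < B := Finset.prod_pos fun i hi => lt_of_lt_of_le hApos (hf i (mem_range.1 hi))
  have hBK : B ≤ 2 ^ s * K := by
    rw [hK, hB]; exact Finset.prod_le_prod' fun i _ => Nat.le_succ _
  apply le_antisymm
  · -- upper bound: `X K < (⌊X/2^s⌋ + 1) B`
    have h1 := mul_prod_succ_le A f s hf hs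
    rw [← hK, ← hB] at h1
    -- `X 2^s K A ≤ X (A + 2s) B < (X + 1) A B`
    have h2 : X * (2 ^ s * K) * A < (X + 1) * B * A := by
      calc X * (2 ^ s * K) * A = X * (A * (2 ^ s * K)) := by ring
        _ ≤ X * ((A + 2 * s) * B) := Nat.mul_le_mul_left _ h1
        _ = X * A * B + 2 * s * X * B := by ring
        _ < X * A * B + A * B := Nat.add_lt_add_left (Nat.mul_lt_mul_of_pos_right hX hBpos) _
        _ = (X + 1) * B * A := by ring
    have h3 : X * (2 ^ s * K) < (X + 1) * B := Nat.lt_of_mul_lt_mul_right h2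
    have h4 : X + 1 ≤ (X / 2 ^ s + 1) * 2 ^ s := by
      have := Nat.lt_div_mul_add (a := X) (Nat.two_pow_pos s)
      linarith
    have h5 : X * K * 2 ^ s < (X / 2 ^ s + 1) * B * 2 ^ s := by
      calc X * K * 2 ^ s = X * (2 ^ s * K) := by ring
        _ < (X + 1) * B := h3
        _ ≤ (X / 2 ^ s + 1) * 2 ^ s * B := Nat.mul_le_mul_right _ h4
        _ = (X / 2 ^ s + 1) * B * 2 ^ s := by ring
    have h6 : X * K < (X / 2 ^ s + 1) * B := Nat.lt_of_mul_lt_mul_right h5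
    exact Nat.lt_succ_iff.1 ((Nat.div_lt_iff_lt_mul hBpos).2 h6)
  · -- lower bound: `⌊X/2^s⌋ B ≤ X K`
    rw [Nat.le_div_iff_mul_le hBpos]
    calc X / 2 ^ s * B ≤ X / 2 ^ s * (2 ^ s * K) := Nat.mul_le_mul_left _ hBK
      _ = (X / 2 ^ s * 2 ^ s) * K := by ring
      _ ≤ X * K := Nat.mul_le_mul_right _ (Nat.div_mul_le_self X (2 ^ s))

/-- **Residues of an exact quotient**: if `binv · B ≡ 1 (mod m)` then
`⌊Y/B⌋ mod m = ((Y mod m + m - (Y mod B) mod m) · binv) mod m`. [cite: HesseAllenderBarrington2002, Lemma 4.5] -/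
theorem div_mod_eq_of_mod (Y B m binv : ℕ) (hm : 0 < m) (hinv : binv * B % m = 1) :
    Y / B % m = ((Y % m + m - (Y % B) % m) * binv) % m := by
  have hY := Nat.div_add_mod Y B
  have h1 : (Y - Y % B) = B * (Y / B) := by omega
  have h2 : (Y - Y % B) % m = (Y % m + m - (Y % B) % m) % m := sub_mod_eq Y (Y % B) m (Nat.mod_le _ _) hm
  rw [h1] at h2
  have h3 : ((Y % m + m - (Y % B) % m) * binv) % m = (B * (Y / B) * binv) % m := by
    rw [Nat.mul_mod, ← h2, ← Nat.mul_mod]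
  rw [h3, show B * (Y / B) * binv = (Y / B) * (binv * B) by ring, Nat.mul_mod, hinv, mul_one, Nat.mod_mod]

/-- **A bit from two consecutive quotients modulo `3`**: with `qₛ = ⌊X/2ˢ⌋`,
`bit_s(X) = (qₛ mod 3 + 6 - 2 (q_{s+1} mod 3)) mod 3` ("to get the `s`-th bit … compute
`u = ⌊X/2ˢ⌋` and `v = ⌊X/2ˢ⁺¹⌋`, the desired bit is `u - 2v` … easy to recognize in CRR", HAB 2002,
proof of Thm. 4.1). [cite: HesseAllenderBarrington2002, Theorem 4.1] -/
theorem testBit_eq_decide_div_mod_three (X s : ℕ) :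
    X.testBit s = decide ((X / 2 ^ s % 3 + 6 - 2 * (X / 2 ^ (s + 1) % 3)) % 3 = 1) := by
  rw [Nat.testBit_eq_decide_div_mod_eq, decide_eq_decide]
  have h : X / 2 ^ s = 2 * (X / 2 ^ (s + 1)) + X / 2 ^ s % 2 := by
    rw [pow_succ, ← Nat.div_div_eq_div_mul]; omega
  generalize X / 2 ^ (s + 1) = v at h ⊢
  generalize X / 2 ^ s = t at h ⊢
  omega

end Halving

/-! ### Inverses modulo a prime -/

/-- **Fermat inverse**: for a prime `p` not dividing `a`, `(a mod p)^{p-2} · a ≡ 1 (mod p)`. [folklore] -/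
theorem mod_pow_sub_two_mul_mod {p a : ℕ} (hp : p.Prime) (ha : a % p ≠ 0) : (a % p) ^ (p - 2) * a % p = 1 := by
  have h1 : (a % p) ^ (p - 2) * a % p = (a % p) ^ (p - 1) % p := by
    rw [Nat.mul_mod, Nat.pow_mod, Nat.mod_mod, ← Nat.pow_mod, ← Nat.mul_mod, ← pow_succ,
      show p - 2 + 1 = p - 1 by have := hp.two_le; omega]
    exact Nat.pow_mod a (p - 1) p
  rw [h1]
  exact pow_sub_one_mod_prime hp (Nat.pos_of_ne_zero ha) (Nat.mod_lt _ hp.pos)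

/-- Modulo `3`, every unit is its own inverse: `b · b ≡ 1 (mod 3)` for `b mod 3 ≠ 0`. [folklore] -/
theorem mul_self_mod_three {b : ℕ} (hb : b % 3 ≠ 0) : b * b % 3 = 1 := by
  rw [Nat.mul_mod]
  have : b % 3 < 3 := Nat.mod_lt _ (by norm_num)
  interval_cases h : b % 3 <;> simp_all

end Literature.Computability.Complexity
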